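import Summits.KontsevichZagierPeriods.KontsevichZagierPeriods.Theorems.LinRedNormalFormArrangementNormalFormStubRebaseSimplePosOneFibreParPiece

/-!
# Stub `stub_rebaseSimplePosOne`, residual hypothesis `Hpar` (crux `ArrangementNormalForm`,
line `janus-bands`, v6.2) — sub-part `ParPole`

**The base pole never meets the `y`-range of a product cell** (a consequence of absolute
convergence). For the data of `Hpar` over a PRODUCT cell `{x'-rows M₀} × (ylo(x'), yhi(x'))`
(one lettered fibre `u(x', y) < t < v(x', y)` with letter `0`, `0 < u < v`, integrand
`R(x')/(y − ℓ₂(x')) · 1/t`, `R = p/∏ Lⱼ^{eⱼ}` not identically zero: `p ≠ 0` and `Lⱼ ≠ 0`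
whenever `eⱼ ≠ 0`), the pole `ℓ₂(x')` never lies strictly inside `(ylo(x'), yhi(x'))`
(`RebasePos.pole_outside`): otherwise, after the coordinate swap `y ↔ t` (so that `y` is the
last coordinate), over every base point `(x', t)` of a set of POSITIVE measure the `y`-fibre of
`|integrand| = |R(x')/t| · |y − ℓ₂(x')|⁻¹` contains the pole and diverges
(`IntegrateOut.lintegral_enorm_div_pow_eq_top`), contradicting Tonelli
(`IntegrateOut.volume_eq_zero_of_lintegral_fibre_eq_top`). Registered as
`rebaseSimplePos_poleOutside`; it discharges the hypothesis `hpole` of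
`rebaseSimplePos_par_nonpinch`.

References: M. Kontsevich, D. Zagier, *Periods* (2001), §1.1 (absolute convergence).
-/

noncomputable section

open Set MeasureTheory MvPolynomial
open Literature.NumberTheory.Transcendental Literature.ModelTheory.ExponentialFields

namespace Summit.KontsevichZagierPeriods.ArrangementNormalForm.JanusBands

namespace RebasePos

open SeparatePos IntegrateOut

section Pole

variable {B m m' m₀ : ℕ} (L : Fin m → (Fin B → ℚ) × ℚ) (e : Fin m → ℕ) (ℓ₁ ℓ₂ : (Fin B → ℚ) × ℚ)

/-- `x'`-forms are continuous. -/
theorem continuous_affB_one (d : (Fin B → ℚ) × ℚ) : Continuous (affB B 1 d) := by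
  unfold affB
  fun_prop

/-- `x'`-forms at a point `snoc x y` (last coordinate `y`) do not depend on `y`. -/
theorem affB_snoc (d : (Fin B → ℚ) × ℚ) (x : Fin (B + 1) → ℝ) (y y' : ℝ) :
    affB B 1 d (Fin.snoc x y : Fin (B + 1 + 1) → ℝ) = affB B 1 d (Fin.snoc x y' : Fin (B + 1 + 1) → ℝ) := by
  unfold affB
  congr 1
  refine Finset.sum_congr rfl fun i _ => ?_
  congr 1
  show (Fin.snoc x y : Fin (B + 1 + 1) → ℝ) (Fin.castSucc (Fin.castSucc i)) =
    (Fin.snoc x y' : Fin (B + 1 + 1) → ℝ) (Fin.castSucc (Fin.castSucc i))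
  rw [Fin.snoc_castSucc, Fin.snoc_castSucc]

/-- The `t`-slot of `snoc x y`. -/
theorem snoc_tslot (x : Fin (B + 1) → ℝ) (y : ℝ) :
    (Fin.snoc x y : Fin (B + 1 + 1) → ℝ) (Fin.castAdd 1 (Fin.last B)) = x (Fin.last B) := by
  show (Fin.snoc x y : Fin (B + 1 + 1) → ℝ) (Fin.castSucc (Fin.last B)) = x (Fin.last B)
  rw [Fin.snoc_castSucc]

/-- The `y`-slot of `snoc x y`. -/
theorem snoc_yslot (x : Fin (B + 1) → ℝ) (y : ℝ) :
    (Fin.snoc x y : Fin (B + 1 + 1) → ℝ) (Fin.natAdd (B + 1) 0) = y := by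
  have : (Fin.natAdd (B + 1) (0 : Fin 1) : Fin (B + 1 + 1)) = Fin.last (B + 1) := Fin.ext (by simp)
  rw [this, Fin.snoc_last]

/-- The `x'`-slots of `snoc x y`. -/
theorem snoc_xslot (x : Fin (B + 1) → ℝ) (y : ℝ) (i : Fin B) :
    (Fin.snoc x y : Fin (B + 1 + 1) → ℝ) (Fin.castAdd 1 (Fin.castSucc i)) = x (Fin.castSucc i) := by
  show (Fin.snoc x y : Fin (B + 1 + 1) → ℝ) (Fin.castSucc (Fin.castSucc i)) = x (Fin.castSucc i)
  rw [Fin.snoc_castSucc]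

/-- **The base pole never meets the `y`-range of a product cell.** See the module docstring. -/
theorem pole_outside (s : KZ.IntegralRep (B + 1 + 1)) (M : Fin m' → (Fin (B + 1) → ℚ) × ℚ)
    (M₀ : Fin m₀ → (Fin B → ℚ) × ℚ) (ylo yhi : (Fin B → ℚ) × ℚ) (p : MvPolynomial (Fin B) ℚ)
    (u v : (Fin (B + 1) → ℚ) × ℚ)
    (hdom : s.domain = gDom B 1 m' M (fun _ => Sum.inr u) (fun _ => Sum.inr v))
    (hint : EqOn s.integrand (glit B 1 p L e ℓ₁ ℓ₂ 0 1 (fun _ => some 0)) s.domain)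
    (hpar : u.1 (Fin.last B) = v.1 (Fin.last B))
    (hcell : ∀ z : Fin (B + 1 + 1) → ℝ, (∀ j, 0 < affF B 1 (M j) z) → 0 < affF B 1 u z ∧ affF B 1 u z < affF B 1 v z)
    (hsec : ∀ z : Fin (B + 1 + 1) → ℝ, (∀ j, 0 < affF B 1 (M j) z) ↔ ((∀ j, 0 < affB B 1 (M₀ j) z) ∧
      affB B 1 ylo z < z (Fin.castAdd 1 (Fin.last B)) ∧ z (Fin.castAdd 1 (Fin.last B)) < affB B 1 yhi z))
    (hp : p ≠ 0) (hL : ∀ j, e j ≠ 0 → L j ≠ 0) :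
    ∀ z : Fin (B + 1 + 1) → ℝ, (∀ j, 0 < affB B 1 (M₀ j) z) →
      affB B 1 ℓ₂ z ≤ affB B 1 ylo z ∨ affB B 1 yhi z ≤ affB B 1 ℓ₂ z := by
  by_contra hcon
  push Not at hcon
  obtain ⟨z₀, hz₀, hlo₀, hhi₀⟩ := hcon
  set sR : ℝ := (u.1 (Fin.last B) : ℝ) with hsR
  -- the swap `y ↔ t`
  set e₂ : Fin (B + 1 + 1) ≃ Fin (B + 1 + 1) := Equiv.swap (Fin.castAdd 1 (Fin.last B)) (Fin.natAdd (B + 1) (0 : Fin 1))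
    with he₂
  have hxslot : ∀ (w : Fin (B + 1 + 1) → ℝ) (i : Fin B), w (e₂ (Fin.castAdd 1 (Fin.castSucc i))) =
      w (Fin.castAdd 1 (Fin.castSucc i)) := by
    intro w i
    rw [he₂, Equiv.swap_apply_of_ne_of_ne]
    · intro h; have := congrArg Fin.val h; simp at this; omega
    · intro h; have := congrArg Fin.val h; simp at this; omega
  have haffB : ∀ (d : (Fin B → ℚ) × ℚ) (w : Fin (B + 1 + 1) → ℝ), affB B 1 d (fun i => w (e₂ i)) = affB B 1 d w :=
    fun d w => by simp only [affB, hxslot]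
  have hYT : ∀ w : Fin (B + 1 + 1) → ℝ, w (e₂ (Fin.castAdd 1 (Fin.last B))) = w (Fin.natAdd (B + 1) 0) ∧
      w (e₂ (Fin.natAdd (B + 1) 0)) = w (Fin.castAdd 1 (Fin.last B)) := fun w => by
    rw [he₂, Equiv.swap_apply_left, Equiv.swap_apply_right]; exact ⟨rfl, rfl⟩
  set s' := s.reindex e₂ with hs'
  -- the set `A₀` (coordinates `(x', t, y)`), the null set `N`, and `A = A₀ \\ N`
  set A₀ : Set (Fin (B + 1 + 1) → ℝ) := {w | (∀ j, 0 < affB B 1 (M₀ j) w) ∧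
      (affB B 1 ylo w < w (Fin.natAdd (B + 1) 0) ∧ w (Fin.natAdd (B + 1) 0) < affB B 1 yhi w) ∧
      (sR * w (Fin.natAdd (B + 1) 0) + affB B 1 (restr B u) w < w (Fin.castAdd 1 (Fin.last B)) ∧
        w (Fin.castAdd 1 (Fin.last B)) < sR * w (Fin.natAdd (B + 1) 0) + affB B 1 (restr B v) w) ∧
      (affB B 1 ylo w < affB B 1 ℓ₂ w ∧ affB B 1 ℓ₂ w < affB B 1 yhi w) ∧
      (sR * affB B 1 ℓ₂ w + affB B 1 (restr B u) w < w (Fin.castAdd 1 (Fin.last B)) ∧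
        w (Fin.castAdd 1 (Fin.last B)) < sR * affB B 1 ℓ₂ w + affB B 1 (restr B v) w)} with hA₀
  set N : Set (Fin (B + 1 + 1) → ℝ) := {w | MvPolynomial.aeval (fun i => w (Fin.castAdd 1 (Fin.castSucc i))) p = 0} ∪
      ⋃ j : Fin m, {w | e j ≠ 0 ∧ affB B 1 (L j) w = 0} with hN
  set A : Set (Fin (B + 1 + 1) → ℝ) := A₀ \ N with hA
  -- (1) `A ⊆ s'.domain`
  have hAsub : A ⊆ s'.domain := by
    intro w hw
    obtain ⟨⟨hrow, ⟨hy1, hy2⟩, ⟨ht1, ht2⟩, -, -⟩, -⟩ := hw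
    show (fun i => w (e₂ i)) ∈ s.domain
    rw [hdom, mem_gDom_one, hsec, (hYT w).1, (hYT w).2, affF_split u, affF_split v, (hYT w).1, ← hpar, ← hsR]
    simp only [haffB]
    exact ⟨⟨hrow, hy1, hy2⟩, ht1, ht2⟩
  -- (2) `A₀` is open and non-empty, `N` is null
  have hcB := continuous_affB_one (B := B)
  have hct : Continuous fun w : Fin (B + 1 + 1) → ℝ => w (Fin.castAdd 1 (Fin.last B)) := continuous_apply _
  have hcy : Continuous fun w : Fin (B + 1 + 1) → ℝ => w (Fin.natAdd (B + 1) 0) := continuous_apply _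
  have hA₀open : IsOpen A₀ := by
    rw [hA₀]
    simp only [setOf_and, setOf_forall]
    refine (isOpen_iInter_of_finite fun j => isOpen_lt continuous_const (hcB _)).inter ?_
    refine ((isOpen_lt (hcB _) hcy).inter (isOpen_lt hcy (hcB _))).inter ?_
    refine ((isOpen_lt ((continuous_const.mul hcy).add (hcB _)) hct).inter
      (isOpen_lt hct ((continuous_const.mul hcy).add (hcB _)))).inter ?_
    refine ((isOpen_lt (hcB _) (hcB _)).inter (isOpen_lt (hcB _) (hcB _))).inter ?_
    exact (isOpen_lt ((continuous_const.mul (hcB _)).add (hcB _)) hct).inter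
      (isOpen_lt hct ((continuous_const.mul (hcB _)).add (hcB _)))
  have hA₀ne : A₀.Nonempty := by
    -- the point `(x'₀, t₀, ℓ₂(x'₀))` with `t₀` the midpoint of `(u, v)` at `y = ℓ₂(x'₀)`
    set c₀ : ℝ := affB B 1 ℓ₂ z₀ with hc₀
    set zc : Fin (B + 1 + 1) → ℝ := Function.update z₀ (Fin.castAdd 1 (Fin.last B)) c₀ with hzc
    have hupd : ∀ d : (Fin B → ℚ) × ℚ, affB B 1 d zc = affB B 1 d z₀ := fun d => by
      rw [hzc]
      unfold affB
      congr 1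
      refine Finset.sum_congr rfl fun i _ => ?_
      rw [Function.update_of_ne]
      intro h
      have := congrArg Fin.val h
      simp at this
      omega
    have hzc_rows : ∀ j, 0 < affF B 1 (M j) zc := (hsec zc).2
      ⟨fun j => by rw [hupd]; exact hz₀ j, by rw [hupd, hzc, Function.update_self]; exact hlo₀,
        by rw [hupd, hzc, Function.update_self]; exact hhi₀⟩
    obtain ⟨-, huv⟩ := hcell zc hzc_rows
    rw [affF_split u, affF_split v, hzc, Function.update_self, ← hzc, hupd, hupd, ← hpar, ← hsR] at huv
    set t₀ : ℝ := (sR * c₀ + affB B 1 (restr B u) z₀ + (sR * c₀ + affB B 1 (restr B v) z₀)) / 2 with ht₀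
    set w₀ : Fin (B + 1 + 1) → ℝ := Fin.append (Fin.snoc (fun i : Fin B => z₀ (Fin.castAdd 1 (Fin.castSucc i))) t₀)
      (fun _ : Fin 1 => c₀) with hw₀
    have hwB : ∀ d : (Fin B → ℚ) × ℚ, affB B 1 d w₀ = affB B 1 d z₀ := fun d => by
      rw [hw₀]; simp only [affB, Fin.append_left, Fin.snoc_castSucc]
    have hwt : w₀ (Fin.castAdd 1 (Fin.last B)) = t₀ := by rw [hw₀, Fin.append_left, Fin.snoc_last]
    have hwy : w₀ (Fin.natAdd (B + 1) 0) = c₀ := by rw [hw₀, Fin.append_right]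
    refine ⟨w₀, ?_⟩
    rw [hA₀]
    simp only [mem_setOf_eq, hwB, hwt, hwy]
    refine ⟨hz₀, ⟨hlo₀, hhi₀⟩, ⟨by rw [ht₀]; linarith, by rw [ht₀]; linarith⟩, ⟨hlo₀, hhi₀⟩,
      by rw [ht₀]; linarith, by rw [ht₀]; linarith⟩
  have hNnull : volume N = 0 := by
    rw [hN]
    refine measure_union_null ?_ (measure_iUnion_null fun j => ?_)
    · have hι : Function.Injective (fun i : Fin B => (Fin.castAdd 1 (Fin.castSucc i) : Fin (B + 1 + 1))) :=
        fun i j hij => by simpa [Fin.ext_iff] using hij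
      have hq : MvPolynomial.map (algebraMap ℚ ℝ)
          (rename (fun i : Fin B => (Fin.castAdd 1 (Fin.castSucc i) : Fin (B + 1 + 1))) p) ≠ 0 := by
        intro h0
        have h1 : rename (fun i : Fin B => (Fin.castAdd 1 (Fin.castSucc i) : Fin (B + 1 + 1))) p = 0 :=
          MvPolynomial.map_injective _ (algebraMap ℚ ℝ).injective (by rw [h0, map_zero])
        exact hp (rename_injective _ hι (h1.trans (map_zero _).symm))
      have hset : {w : Fin (B + 1 + 1) → ℝ | MvPolynomial.aeval (fun i => w (Fin.castAdd 1 (Fin.castSucc i))) p = 0} =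
          {w | MvPolynomial.aeval w (rename (fun i : Fin B => (Fin.castAdd 1 (Fin.castSucc i) : Fin (B + 1 + 1))) p) = 0} := by
        ext w
        simp only [mem_setOf_eq, aeval_rename, Function.comp_def]
      rw [hset]
      exact volume_setOf_aeval_eq_zero _ hq
    · by_cases hej : e j = 0
      · convert measure_empty (μ := (volume : Measure (Fin (B + 1 + 1) → ℝ))) using 2
        exact Set.eq_empty_iff_forall_notMem.2 fun w hw => hw.1 hej
      · have hLj : ((Fin.snoc (L j).1 0 : Fin (B + 1) → ℚ), (L j).2) ≠ (0 : (Fin (B + 1) → ℚ) × ℚ) := by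
          intro h0
          apply hL j hej
          refine Prod.ext (funext fun i => ?_) ?_
          · have := congrArg (fun q : (Fin (B + 1) → ℚ) × ℚ => q.1 (Fin.castSucc i)) h0
            simpa using this
          · have := congrArg Prod.snd h0
            simpa using this
        refine measure_mono_null (fun w hw => ?_) (volume_form_eq_zero (k := 1) _ hLj)
        have h2 := hw.2
        rw [← affF_liftB] at h2
        exact h2
  have hcp : Continuous fun w : Fin (B + 1 + 1) → ℝ =>
      MvPolynomial.aeval (fun i => w (Fin.castAdd 1 (Fin.castSucc i))) p := by
    have h : (fun w : Fin (B + 1 + 1) → ℝ => MvPolynomial.aeval (fun i => w (Fin.castAdd 1 (Fin.castSucc i))) p) =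
        fun w => eval w (MvPolynomial.map (algebraMap ℚ ℝ)
          (rename (fun i : Fin B => (Fin.castAdd 1 (Fin.castSucc i) : Fin (B + 1 + 1))) p)) := by
      funext w
      rw [eval_map, ← aeval_def, aeval_rename, Function.comp_def]
    rw [h]
    exact MvPolynomial.continuous_eval _
  have hNclosed : IsClosed N := by
    rw [hN]
    refine (isClosed_eq hcp continuous_const).union (isClosed_iUnion_of_finite fun j => ?_)
    by_cases hej : e j = 0
    · have : {w : Fin (B + 1 + 1) → ℝ | e j ≠ 0 ∧ affB B 1 (L j) w = 0} = ∅ :=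
        Set.eq_empty_iff_forall_notMem.2 fun w hw => hw.1 hej
      rw [this]
      exact isClosed_empty
    · have : {w : Fin (B + 1 + 1) → ℝ | e j ≠ 0 ∧ affB B 1 (L j) w = 0} = {w | affB B 1 (L j) w = 0} := by
        ext w
        simp [hej]
      rw [this]
      exact isClosed_eq (hcB _) continuous_const
  have hAopen : IsOpen A := hA₀open.sdiff hNclosed
  have hApos : 0 < volume A := by
    rw [hA, measure_sdiff_null hNnull]
    exact hA₀open.measure_pos volume hA₀ne
  -- (3) membership of `snoc x y` in `A`: the `y`-free part and the `y`-part
  have hmemA : ∀ (x : Fin (B + 1) → ℝ) (y : ℝ), (Fin.snoc x y : Fin (B + 1 + 1) → ℝ) ∈ A ↔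
      (((∀ j, 0 < affB B 1 (M₀ j) (Fin.snoc x 0 : Fin (B + 1 + 1) → ℝ)) ∧
        (affB B 1 ylo (Fin.snoc x 0 : Fin (B + 1 + 1) → ℝ) < affB B 1 ℓ₂ (Fin.snoc x 0 : Fin (B + 1 + 1) → ℝ) ∧
          affB B 1 ℓ₂ (Fin.snoc x 0 : Fin (B + 1 + 1) → ℝ) < affB B 1 yhi (Fin.snoc x 0 : Fin (B + 1 + 1) → ℝ)) ∧
        (sR * affB B 1 ℓ₂ (Fin.snoc x 0 : Fin (B + 1 + 1) → ℝ) + affB B 1 (restr B u) (Fin.snoc x 0 : Fin (B + 1 + 1) → ℝ) <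
            x (Fin.last B) ∧
          x (Fin.last B) < sR * affB B 1 ℓ₂ (Fin.snoc x 0 : Fin (B + 1 + 1) → ℝ) +
            affB B 1 (restr B v) (Fin.snoc x 0 : Fin (B + 1 + 1) → ℝ)) ∧
        ¬ (MvPolynomial.aeval (fun i => x (Fin.castSucc i)) p = 0 ∨
          ∃ j, e j ≠ 0 ∧ affB B 1 (L j) (Fin.snoc x 0 : Fin (B + 1 + 1) → ℝ) = 0)) ∧
      (affB B 1 ylo (Fin.snoc x 0 : Fin (B + 1 + 1) → ℝ) < y ∧ y < affB B 1 yhi (Fin.snoc x 0 : Fin (B + 1 + 1) → ℝ)) ∧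
      (sR * y + affB B 1 (restr B u) (Fin.snoc x 0 : Fin (B + 1 + 1) → ℝ) < x (Fin.last B) ∧
        x (Fin.last B) < sR * y + affB B 1 (restr B v) (Fin.snoc x 0 : Fin (B + 1 + 1) → ℝ))) := by
    intro x y
    rw [hA, hA₀, hN]
    simp only [mem_sdiff, mem_setOf_eq, mem_union, mem_iUnion, affB_snoc _ x y 0, snoc_tslot, snoc_yslot, snoc_xslot]
    tauto
  -- (4) Tonelli: every non-empty `y`-fibre of `A` contains the pole and diverges
  have hint' : IntegrableOn s'.integrand A := s'.integrableOn.mono_set hAsub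
  have hzero : volume A = 0 := by
    refine volume_eq_zero_of_lintegral_fibre_eq_top hAopen.measurableSet hint' fun x => ?_
    set c : ℝ := affB B 1 ℓ₂ (Fin.snoc x 0 : Fin (B + 1 + 1) → ℝ) with hc
    by_cases hcx : (Fin.snoc x c : Fin (B + 1 + 1) → ℝ) ∈ A
    · right
      -- the fibre is open and contains the pole `c`
      set F : Set ℝ := {y : ℝ | (Fin.snoc x y : Fin (B + 1 + 1) → ℝ) ∈ A} with hF
      have hFo : IsOpen F := hAopen.preimage (continuous_snoc x)
      obtain ⟨δ, hδ, hball⟩ := Metric.isOpen_iff.1 hFo c hcx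
      rw [Real.ball_eq_Ioo] at hball
      -- the constant `K = R(x')/t`
      obtain ⟨⟨hrow, ⟨hcl, hch⟩, ⟨hu1, hu2⟩, hnot⟩, -, -⟩ := (hmemA x c).1 hcx
      push Not at hnot
      obtain ⟨hpx, hLx⟩ := hnot
      set Rx : ℝ := MvPolynomial.aeval (fun i => x (Fin.castSucc i)) p /
        ∏ j, (affB B 1 (L j) (Fin.snoc x 0 : Fin (B + 1 + 1) → ℝ)) ^ e j with hRxdef
      set t : ℝ := x (Fin.last B) with htx
      -- `t > 0`: the lower bound `u` is positive at `(x', ℓ₂)`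
      have htpos : 0 < t := by
        have hmem : (fun i => (Fin.snoc x c : Fin (B + 1 + 1) → ℝ) (e₂ i)) ∈ s.domain := hAsub hcx
        rw [hdom, mem_gDom_one] at hmem
        have hupos := (hcell _ hmem.1).1
        rw [affF_split u, (hYT (Fin.snoc x c : Fin (B + 1 + 1) → ℝ)).1, haffB, snoc_yslot, affB_snoc _ x c 0, ← hsR] at hupos
        linarith
      have hRx0 : Rx ≠ 0 := by
        rw [hRxdef]
        refine div_ne_zero hpx (Finset.prod_ne_zero_iff.2 fun j _ => ?_)
        by_cases hej : e j = 0
        · rw [hej, pow_zero]; exact one_ne_zero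
        · exact pow_ne_zero _ (hLx j hej)
      have hK : Rx / t ≠ 0 := div_ne_zero hRx0 htpos.ne'
      -- the integrand on the fibre
      have hval : ∀ y ∈ F, s'.integrand (Fin.snoc x y) = Rx / t / (y - c) ^ 1 := by
        intro y hy
        have hmem : (fun i => (Fin.snoc x y : Fin (B + 1 + 1) → ℝ) (e₂ i)) ∈ s.domain := hAsub hy
        show s.integrand (fun i => (Fin.snoc x y : Fin (B + 1 + 1) → ℝ) (e₂ i)) = _
        rw [hint hmem, glit_one, pow_zero, pow_one, pow_one, (hYT (Fin.snoc x y : Fin (B + 1 + 1) → ℝ)).1,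
          (hYT (Fin.snoc x y : Fin (B + 1 + 1) → ℝ)).2, affF_zero'', sub_zero, snoc_yslot, snoc_tslot, hRxdef, htx]
        simp only [hxslot, snoc_xslot, haffB, affB_snoc _ x y 0]
        rw [← hc]
        ring
      refine top_le_iff.1 ?_
      calc (⊤ : ENNReal) = ∫⁻ y in Ioo (c - δ) (c + δ), ‖Rx / t / (y - c) ^ 1‖ₑ :=
            (lintegral_enorm_div_pow_eq_top hK (by linarith) ⟨by linarith, by linarith⟩ le_rfl).symm
        _ = ∫⁻ y in Ioo (c - δ) (c + δ), ‖s'.integrand (Fin.snoc x y)‖ₑ :=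
            setLIntegral_congr_fun measurableSet_Ioo fun y hy => by rw [hval y (hball hy)]
        _ ≤ ∫⁻ y in F, ‖s'.integrand (Fin.snoc x y)‖ₑ := lintegral_mono_set hball
    · left
      refine Set.eq_empty_iff_forall_notMem.2 fun y hy => hcx ?_
      obtain ⟨hP, -, -⟩ := (hmemA x y).1 hy
      have hP2 := hP
      obtain ⟨-, ⟨hcl, hch⟩, ⟨hu1, hu2⟩, -⟩ := hP2
      exact (hmemA x c).2 ⟨hP, ⟨hcl, hch⟩, hu1, hu2⟩
  exact absurd hzero hApos.ne'

end Pole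

end RebasePos

/-- **Registered support goal of this file: the base pole never meets the `y`-range of a product
cell** (`RebasePos.pole_outside`), for the data of `Hpar` with a non-trivial `x'`-factor
(`p ≠ 0`, `Lⱼ ≠ 0` when `eⱼ ≠ 0`): absolute convergence forces `ℓ₂ ≤ ylo ∨ yhi ≤ ℓ₂` at every
point of the `x'`-cell. -/
theorem rebaseSimplePos_poleOutside (B m m' m₀ : ℕ) (L : Fin m → (Fin B → ℚ) × ℚ) (e : Fin m → ℕ) (ℓ₁ ℓ₂ : (Fin B → ℚ) × ℚ) (s : KZ.IntegralRep (B + 1 + 1)) (M : Fin m' → (Fin (B + 1) → ℚ) × ℚ) (M₀ : Fin m₀ → (Fin B → ℚ) × ℚ) (ylo yhi : (Fin B → ℚ) × ℚ) (p : MvPolynomial (Fin B) ℚ) (u v : (Fin (B + 1) → ℚ) × ℚ) (hdom : s.domain = SeparatePos.gDom B 1 m' M (fun _ => Sum.inr u) (fun _ => Sum.inr v)) (hint : Set.EqOn s.integrand (RebasePos.glit B 1 p L e ℓ₁ ℓ₂ 0 1 (fun _ => some 0)) s.domain) (hpar : u.1 (Fin.last B) = v.1 (Fin.last B)) (hcell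 : ∀ z : Fin (B + 1 + 1) → ℝ, (∀ j, 0 < SeparatePos.affF B 1 (M j) z) → 0 < SeparatePos.affF B 1 u z ∧ SeparatePos.affF B 1 u z < SeparatePos.affF B 1 v z) (hsec : ∀ z : Fin (B + 1 + 1) → ℝ, (∀ j, 0 < SeparatePos.affF B 1 (M j) z) ↔ ((∀ j, 0 < SeparatePos.affB B 1 (M₀ j) z) ∧ SeparatePos.affB B 1 ylo z < z (Fin.castAdd 1 (Fin.last B)) ∧ z (Fin.castAdd 1 (Fin.last B)) < SeparatePos.affB B 1 yhi z)) (hp : p ≠ 0) (hL : ∀ j, e j ≠ 0 → L j ≠ 0) : ∀ z : Fin (B + 1 + 1) → ℝ, (∀ j, 0 < SeparatePos.affB B 1 (M₀ j) z) → SeparatePos.affB B 1 ℓ₂ z ≤ SeparatePos.affB B 1 ylo z ∨ SeparatePos.affB B 1 yhi z ≤ SeparatePos.affB B 1 ℓ₂ z :=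
  RebasePos.pole_outside L e ℓ₁ ℓ₂ s M M₀ ylo yhi p u v hdom hint hpar hcell hsec hp hL

end Summit.KontsevichZagierPeriods.ArrangementNormalForm.JanusBands
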